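import Mathlib
import HarnessLib
import Summits.HubbardSuperconductivity.HubbardSuperconductivity.Theorems.KLProgrammeC4aPartnerBandChartPoint
import Summits.HubbardSuperconductivity.HubbardSuperconductivity.Theorems.KLProgrammeC4aPartnerBandCooperDefect
import Summits.HubbardSuperconductivity.HubbardSuperconductivity.Theorems.KLProgrammeC4aLevelDensityRadialVertex
import Summits.HubbardSuperconductivity.HubbardSuperconductivity.Theorems.KLProgrammeC4aPathJets

/-!
# Route `KLProgramme` — crux C4a, S3 brick (B4) «(U1)-LAWS» part 9: the LOOP-WINDOW DICHOTOMY away from the caustic — a loop window with no near-caustic point (and no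
# Cooper configuration) is, at every `ϑ`, either FAR (`|ē(0,·)| ≥ d₁` on the window) or TRANSVERSAL at EVERY loop level `|e| ≤ hi` (`|∂_vē(e,·)| > λ` on the window)

Cell `gate-hubbard-kl`, seat hubbard-kl-k3c3-p3 (g32; row «implicit-function / monotonicity route for μ(n)»).  Located brick for the (C)-closer lane / the (M4)
assembly of the umklapp first-order ϑ-layer (stub (C) `stub_twoLeg_curvature` of `KLRegimeEngineV17F2`, stmt-HubbardSuperconductivity-20437), memo
HOME/hubbard-kl-k3c3-p3/U1-CAUSTIC-SUP.md §14 (the classification feeding parts 7 and 8).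

WHY.  Parts 7 (`…C4aFarBoxRows`) and 8 (`…C4aMonotoneBoxRows`) bound `F(ϑ)` on a box from, respectively, `|ē(0,v;ϑ)| ≥ d₁` on the loop window and a slope floor
`|∂_vē(e,v;ϑ)| ≥ m` at every loop level of the tube section.  This file supplies the DICHOTOMY that dispatches a loop window to one of them when it carries no
near-caustic point: p650444's sheet-uniform row `…C4aPartnerBandChartPoint.abs_deriv_partnerBand_pp_angle_gt_of_sheets` (at ANY loop level `e`: partner level within
`ε` of `e`, not `(λ,ε)`-Cooper and outside the `(λ,ε,|e|)`-margin of every sheet's caustic ⟹ `|∂_vē| > λ`) + two Lipschitz rows of the band (`K₁·msD₁` in the loop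
angle at level `0`, `K₁/(Dt−2A)` in the loop level — `…CooperDefect.abs_frameLevel_sub_le`, `…PathJets.norm_iteratedDeriv_levelPoint_le`,
`…LevelDensityRadialVertex.norm_levelPoint_sub_levelPoint_le`): if ONE point of the window has `|ē(0,v₀)| < d₁` then EVERY `(e,v)` of the tube section over the window has
`|ē(e,v)| < d₁ + K₁msD₁(φb−φa) + K₁hi/(Dt−2A)`, hence `|ē − e| ≤ ε` with `ε ≥ (that) + hi`, and the row fires at `(e,v)` itself — no Lipschitz control of the SLOPE is needed.
* **`loopWindow_far_or_transversal`** (HEADLINE): `GeomConstants`; loop window `[φa,φb]`, levels `0 ≤ hi < min(r, r₀)`, `ε` with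
  `d₁ + K₁msD₁(φb−φa) + K₁hi/(Dt−2A) + hi ≤ ε ≤ r`; at the configuration `(ρ,ϑ,θ)`: not `(λ,ε)`-Cooper for any sheet (`hC`) and, at every loop angle of the window, outside
  the `(λ, ε, hi)`-margin of every sheet's caustic (`hT`, the complement of the near-caustic witness condition at scale that margin) ⟹
  `(∀ v ∈ [φa,φb], d₁ ≤ |ē(0,v)|) ∨ (∀ |e| ≤ hi, ∀ v ∈ [φa,φb], λ < |∂_vē(e,v)|)` — the `hfar` of part 7 or the `hslope` of part 8 at this `ϑ`.
Sizes binder shape + `GeomConstants`; nothing asserts (C), K3 or superconductivity.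
References: BGM 2003 §7.1 Lemma 7.1 (A1.9) [cite: BenfattoGiulianiMastropietro2003]; FST II CPAM 51 (1998) §3 [cite: FeldmanSalmhoferTrubowitz1998].
-/

noncomputable section

namespace Summit.HubbardSuperconductivity.HubbardSuperconductivity.Theorems.C4a

set_option linter.dupNamespace false -- summit = problem name (single-conjunct summit), D-0017

open Real Set
open Literature.MathematicalPhysics.QuantumLattice Literature.MathematicalPhysics.QuantumLattice.BandSectorCounting
open Literature.MathematicalPhysics.QuantumLattice.FermiRG
open Summit.HubbardSuperconductivity.HubbardSuperconductivity.Theorems.KLRegimeSplit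
open Summit.HubbardSuperconductivity.HubbardSuperconductivity.Theorems.DispersionFlow
open Summit.HubbardSuperconductivity.HubbardSuperconductivity.Theorems.PerturbedFermiCurve

section Sizes

variable {K : TrigPolyC4v} {A : ℝ} (hA : ∀ p : Momentum, ∀ j ≤ 2, ‖iteratedFDeriv ℝ j (frameShift K) p‖ ≤ A) (hA20 : A ≤ 1 / 20)
  (hd : klCurveD ≤ (bandBounds (show (-4 : ℝ) < -1.1 by norm_num) (show (-1.1 : ℝ) ≤ -0.1 by norm_num)
    (show (-0.1 : ℝ) < 0 by norm_num)).Dtmin - 2 * A)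
  {μ r : ℝ} (hr : 0 < r) (hlo : (-1.1 : ℝ) < μ - r - A) (hhi : μ + r + A < -0.1)
  {A₃ A₄ : ℝ} (hA₃ : ∀ p : Momentum, ‖iteratedFDeriv ℝ 3 (frameShift K) p‖ ≤ A₃)
  (hA₄ : ∀ p : Momentum, ‖iteratedFDeriv ℝ 4 (frameShift K) p‖ ≤ A₄)
  {K₁ : ℝ} (hK₁ : ∀ p : Momentum, ‖fderiv ℝ (frameLevel μ K) p‖ ≤ K₁)
include hA hA20 hd hr hlo hhi hA₃ hA₄ hK₁

set_option maxHeartbeats 400000 in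
/-- **THE LOOP-WINDOW DICHOTOMY AWAY FROM THE CAUSTIC** (HEADLINE; see the module docstring). -/
theorem loopWindow_far_or_transversal {Kc r₀ g₀ w : ℝ} (hG : GeomConstants (frameLevel μ K) Kc r₀ g₀ w) (ρ ϑ θ : ℝ) {φa φb d₁ hi lam eps : ℝ}
    (hhi0 : 0 ≤ hi) (hhir : hi < r) (hhir₀ : hi < r₀)
    (heps : d₁ + K₁ * (msD A₃ A₄ 1 * (φb - φa)) + K₁ * (hi / ((bandBounds (show (-4 : ℝ) < -1.1 by norm_num) (show (-1.1 : ℝ) ≤ -0.1 by norm_num) (show (-0.1 : ℝ) < 0 by norm_num)).Dtmin - 2 * A)) + hi ≤ eps) (hepsr : eps ≤ r)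
    (hC : ∀ m : Fin 2 → ℤ, msD A₃ A₄ 1 *
            ((π / 2 * lam /
                  (((bandBounds (show (-4 : ℝ) < -1.1 by norm_num) (show (-1.1 : ℝ) ≤ -0.1 by norm_num) (show (-0.1 : ℝ) < 0 by norm_num)).Dtmin -
                      2 * A) *
                    (bandBounds (show (-4 : ℝ) < -1.1 by norm_num) (show (-1.1 : ℝ) ≤ -0.1 by norm_num) (show (-0.1 : ℝ) < 0 by norm_num)).umin) +
                π * Kc * eps / ((bandBounds (show (-4 : ℝ) < -1.1 by norm_num) (show (-1.1 : ℝ) ≤ -0.1 by norm_num)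
                  (show (-0.1 : ℝ) < 0 by norm_num)).Dtmin - 2 * A) ^ 2) /
              ((bandBounds (show (-4 : ℝ) < -1.1 by norm_num) (show (-1.1 : ℝ) ≤ -0.1 by norm_num) (show (-0.1 : ℝ) < 0 by norm_num)).umin * w /
                (4 + 2 * A))) +
          eps / ((bandBounds (show (-4 : ℝ) < -1.1 by norm_num) (show (-1.1 : ℝ) ≤ -0.1 by norm_num) (show (-0.1 : ℝ) < 0 by norm_num)).Dtmin - 2 * A) <
        ‖pairSumPath μ K ρ ϑ θ 0 - WithLp.toLp 2 (fun i => 2 * π * (m i : ℝ))‖)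
    (hT : ∀ v ∈ Icc φa φb, ∀ m : Fin 2 → ℤ, msD A₃ A₄ 1 *
            ((π / 2 * lam /
                  (((bandBounds (show (-4 : ℝ) < -1.1 by norm_num) (show (-1.1 : ℝ) ≤ -0.1 by norm_num) (show (-0.1 : ℝ) < 0 by norm_num)).Dtmin -
                      2 * A) *
                    (bandBounds (show (-4 : ℝ) < -1.1 by norm_num) (show (-1.1 : ℝ) ≤ -0.1 by norm_num) (show (-0.1 : ℝ) < 0 by norm_num)).umin) +
                π * Kc * eps / ((bandBounds (show (-4 : ℝ) < -1.1 by norm_num) (show (-1.1 : ℝ) ≤ -0.1 by norm_num)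
                  (show (-0.1 : ℝ) < 0 by norm_num)).Dtmin - 2 * A) ^ 2) /
              ((bandBounds (show (-4 : ℝ) < -1.1 by norm_num) (show (-1.1 : ℝ) ≤ -0.1 by norm_num) (show (-0.1 : ℝ) < 0 by norm_num)).umin * w /
                (4 + 2 * A))) +
          (2 * hi + eps) / ((bandBounds (show (-4 : ℝ) < -1.1 by norm_num) (show (-1.1 : ℝ) ≤ -0.1 by norm_num) (show (-0.1 : ℝ) < 0 by norm_num)).Dtmin -
            2 * A) <
        ‖pairSumPath μ K ρ ϑ θ 0 - WithLp.toLp 2 (fun i => 2 * π * (m i : ℝ)) - (2 : ℝ) • levelPoint μ K 0 (v + θ)‖) :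
    (∀ v ∈ Icc φa φb, d₁ ≤ |frameLevel μ K (pairSumPath μ K ρ ϑ θ 0 - levelPoint μ K 0 (v + θ))|) ∨
    (∀ e ∈ Icc (-hi) hi, ∀ v ∈ Icc φa φb, lam < |deriv (fun x : ℝ => frameLevel μ K (pairSumPath μ K ρ ϑ θ 0 - levelPoint μ K e (x + θ))) v|) := by
  set B := (bandBounds (show (-4 : ℝ) < -1.1 by norm_num) (show (-1.1 : ℝ) ≤ -0.1 by norm_num) (show (-0.1 : ℝ) < 0 by norm_num)) with hBdef
  set S : Momentum := pairSumPath μ K ρ ϑ θ 0 with hS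
  have hADt : 2 * A < B.Dtmin := by have := klCurveD_pos; linarith only [this, hd]
  have hDt : 0 < B.Dtmin - 2 * A := by linarith only [hADt]
  have hK₁0 : 0 ≤ K₁ := (norm_nonneg _).trans (hK₁ 0)
  have h0r : |(0 : ℝ)| < r := by rw [abs_zero]; exact hr
  have hM : 0 ≤ msD A₃ A₄ 1 := (norm_nonneg _).trans (norm_iteratedDeriv_levelPoint_le hA hA20 hd hlo hhi hA₃ hA₄ h0r le_rfl (by norm_num) 0)
  rcases Classical.em (∀ v ∈ Icc φa φb, d₁ ≤ |frameLevel μ K (S - levelPoint μ K 0 (v + θ))|) with hfar | hfar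
  · exact Or.inl hfar
  right
  obtain ⟨v₀, hv₀, hsmall⟩ : ∃ v₀ ∈ Icc φa φb, |frameLevel μ K (S - levelPoint μ K 0 (v₀ + θ))| < d₁ := by
    simpa only [not_forall, not_le, exists_prop] using hfar
  intro e he v hv
  have heabs : |e| ≤ hi := abs_le.2 ⟨he.1, he.2⟩
  have her : |e| < r := lt_of_le_of_lt heabs hhir
  have her₀ : |e| < r₀ := lt_of_le_of_lt heabs hhir₀
  -- Lipschitz in the loop angle at level 0
  have hΦlip : ‖levelPoint μ K 0 (v + θ) - levelPoint μ K 0 (v₀ + θ)‖ ≤ msD A₃ A₄ 1 * (φb - φa) := by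
    have hdiff : ∀ s ∈ (univ : Set ℝ), DifferentiableAt ℝ (levelPoint μ K 0) s := fun s _ =>
      ((contDiff_levelPoint_angle B hA hADt hlo hhi h0r (m := 1)).differentiable one_ne_zero).differentiableAt
    have hbd : ∀ s ∈ (univ : Set ℝ), ‖deriv (levelPoint μ K 0) s‖ ≤ msD A₃ A₄ 1 := fun s _ => by
      rw [← iteratedDeriv_one]; exact norm_iteratedDeriv_levelPoint_le hA hA20 hd hlo hhi hA₃ hA₄ h0r le_rfl (by norm_num) s
    have h := (convex_univ).norm_image_sub_le_of_norm_deriv_le hdiff hbd (mem_univ (v₀ + θ)) (mem_univ (v + θ))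
    refine h.trans (mul_le_mul_of_nonneg_left ?_ hM)
    rw [show v + θ - (v₀ + θ) = v - v₀ by ring, Real.norm_eq_abs]
    exact abs_sub_le_iff.2 ⟨by linarith [hv.2, hv₀.1], by linarith [hv.1, hv₀.2]⟩
  have hLv : |frameLevel μ K (S - levelPoint μ K 0 (v + θ)) - frameLevel μ K (S - levelPoint μ K 0 (v₀ + θ))| ≤ K₁ * (msD A₃ A₄ 1 * (φb - φa)) := by
    have h1 := abs_frameLevel_sub_le hK₁ (S - levelPoint μ K 0 (v + θ)) (S - levelPoint μ K 0 (v₀ + θ))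
    have h2 : ‖(S - levelPoint μ K 0 (v + θ)) - (S - levelPoint μ K 0 (v₀ + θ))‖ = ‖levelPoint μ K 0 (v + θ) - levelPoint μ K 0 (v₀ + θ)‖ := by
      rw [show (S - levelPoint μ K 0 (v + θ)) - (S - levelPoint μ K 0 (v₀ + θ)) = -(levelPoint μ K 0 (v + θ) - levelPoint μ K 0 (v₀ + θ)) by abel, norm_neg]
    rw [h2] at h1
    exact h1.trans (mul_le_mul_of_nonneg_left hΦlip hK₁0)
  -- Lipschitz in the loop level
  have hLe : |frameLevel μ K (S - levelPoint μ K e (v + θ)) - frameLevel μ K (S - levelPoint μ K 0 (v + θ))| ≤ K₁ * (hi / (B.Dtmin - 2 * A)) := by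
    have heI : e ∈ Ioo (-r) r := ⟨by linarith only [he.1, hhir], lt_of_le_of_lt he.2 hhir⟩
    have h0I : (0 : ℝ) ∈ Ioo (-r) r := ⟨by linarith only [hr], hr⟩
    have h1 := abs_frameLevel_sub_le hK₁ (S - levelPoint μ K e (v + θ)) (S - levelPoint μ K 0 (v + θ))
    have h2 : ‖(S - levelPoint μ K e (v + θ)) - (S - levelPoint μ K 0 (v + θ))‖ = ‖levelPoint μ K e (v + θ) - levelPoint μ K 0 (v + θ)‖ := by
      rw [show (S - levelPoint μ K e (v + θ)) - (S - levelPoint μ K 0 (v + θ)) = -(levelPoint μ K e (v + θ) - levelPoint μ K 0 (v + θ)) by abel, norm_neg]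
    have h3 := norm_levelPoint_sub_levelPoint_le B hA hADt hlo hhi heI h0I (v + θ)
    rw [sub_zero] at h3
    rw [h2] at h1
    exact h1.trans (mul_le_mul_of_nonneg_left (h3.trans (div_le_div_of_nonneg_right heabs hDt.le)) hK₁0)
  -- the partner level at `(e,v)` is small, hence close to `e`
  have hēsmall : |frameLevel μ K (S - levelPoint μ K e (v + θ))| < d₁ + K₁ * (msD A₃ A₄ 1 * (φb - φa)) + K₁ * (hi / (B.Dtmin - 2 * A)) := by
    have t1 := abs_sub_abs_le_abs_sub (frameLevel μ K (S - levelPoint μ K 0 (v + θ))) (frameLevel μ K (S - levelPoint μ K 0 (v₀ + θ)))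
    have t2 := abs_sub_abs_le_abs_sub (frameLevel μ K (S - levelPoint μ K e (v + θ))) (frameLevel μ K (S - levelPoint μ K 0 (v + θ)))
    linarith
  have hē : |frameLevel μ K (S - levelPoint μ K e (v + θ))| < r := by linarith
  have hepsv : |frameLevel μ K (S - levelPoint μ K e (v + θ)) - e| ≤ eps := by
    have h2 : |frameLevel μ K (S - levelPoint μ K e (v + θ)) - e| ≤ |frameLevel μ K (S - levelPoint μ K e (v + θ))| + |e| := abs_sub _ _
    linarith
  -- the margin at `|e| ≤ hi`
  have hmono : (2 * |e| + eps) / (B.Dtmin - 2 * A) ≤ (2 * hi + eps) / (B.Dtmin - 2 * A) := div_le_div_of_nonneg_right (by linarith) hDt.le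
  have hT' := fun m => lt_of_le_of_lt (add_le_add le_rfl hmono) (hT v hv m)
  exact abs_deriv_partnerBand_pp_angle_gt_of_sheets hA hA20 hd hlo hhi hA₃ hA₄ hG her her₀ hē hepsv hC hT'

end Sizes

end Summit.HubbardSuperconductivity.HubbardSuperconductivity.Theorems.C4a

end
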